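import Summits.QuantumFields.YangMills.Theorems.UnitScaleTiltProp7H46RealityTrace
import Summits.QuantumFields.YangMills.Theorems.UnitScaleTiltProp7QTwSRealitySectors
import Summits.QuantumFields.YangMills.Theorems.UnitScaleTiltProp7SectET3WilsonHessianT3SigmaRows
import Summits.QuantumFields.YangMills.Theorems.UnitScaleTiltProp7WilsonHessianSectorRows
import HarnessLib

/-!
# Route `UnitScaleTilt`, crux K1 child «MinimiserStabilityRegPr» (stmt-QuantumFields-19200), skeleton v10, stub `stub_existenceMinimalOrbit` (EX),
# route (α) — **PRINT'S WILSON HESSIAN `Δ^η(U₀)` COMMUTES WITH THE CONJUGATION `X ↦ Xᴴ`** (the displayed row `hΔη` of the (R-H) assembly DISCHARGED BY NAME from p01's Hessian-slot σ-row ✓`DeltaEta_toL2_star`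
# of `…WilsonHessianT3SigmaRows`), hence the knit's (R-H) clause for `H := H46 U₀` modulo the `QTwS` rows and the traceless sector of `Δ^η` only

Cell `ym3-torus`, width seat `ym-ust-20520-w4` (gen 4).  THEOREMS ONLY (0 `def`, 0 `sorry`).  Part (a), part 4 of the ym-inputs-p03 g2 ∕ ★w4-20520 g4 split.  Nothing here closes
the stub; `--supports stmt-QuantumFields-19200 --as helper`, count-neutral.  YM₃ on T³ is a ladder rung (R3), not the Clay problem; nothing here claims the stub, the crux, d = 4 or the gap.

THE PRINT.  [Balaban1985BackgroundPropagators] (3.10)–(3.12) p. 392: `Δ(U₀)` «is a hermitian operator» on `𝔤ᶜ`-valued vector functions, real on `𝔤`-valued ones — p01's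
✓`DeltaEta_toL2_star` (`…WilsonHessianT3SigmaRows`) is exactly the commutation of `Δ^η(U₀)` with the conjugation `σ = toL2 ∘ star ∘ toL2⁻¹` of ✓`Prop7SectET3HilbertLettersReality`,
stated on route fields `X`; here it is re-read on `L²` elements `f` (the binder shape of the assembly) and plugged in.

WHAT IS PROVED (sorry-free, no definition).  ★★ `DeltaEta_star_comm : DeltaEta U₀ (σ f) = σ (DeltaEta U₀ f)` (= p01's ✓`DeltaEta_toL2_star` at `X := toL2⁻¹f`); ★★★ `H46_skewHermitian_traceless_of_rows` — the knit's (R-H) clause for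
`H := H46 U₀` (✓`Prop7H46RealityTrace.H46_skewHermitian_traceless`) with `hΔη` discharged; ★★★ `H46_skewHermitian_traceless_of_regPr` — the same at `U₀ ∈ 𝔘_k(ε₀)` in the two
windows of record with the three `QTwS` rows supplied BY NAME from p03's ✓`Prop7QTwSRealitySectors` (`trace_QTwS_eq_zero_of_regPr` = (Q-a) alone; `QTwS_star_comm_of_regPr_of_realScalar`,
`QTwS_scalar_of_realScalar` from the ONE displayed row (Q-b)ʳ `hscR` «`QTwS U₀` maps real scalar fields to real scalar fields», ★w5-20520 g5's centre-equivariance row): and ★★★ `H46_skewHermitian_traceless_of_regPr_of_realScalar` with `hΔtr` DISCHARGED by ✓`Prop7WilsonHessianSectorRows.trace_DeltaEta_toL2_eq_zero`: REMAINING DISPLAYED ROW = {`hscR` = (Q-b)ʳ} ONLY.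

References: T. Bałaban, CMP 99 (1985) 389–434 [Balaban1985BackgroundPropagators] ((3.10)–(3.12) p.392, (3.126) p.420, p.393); CMP 102 (1985) 277–309 [Balaban1985Variational] ((45)–(46) p.285,
(51) p.286).
-/

set_option autoImplicit false

noncomputable section

open scoped InnerProductSpace ComplexConjugate Matrix.Norms.L2Operator BigOperators

namespace Summit.QuantumFields.YangMills.Theorems.Prop7DeltaEtaStarReality

open Literature.MathematicalPhysics.QuantumFieldTheory.Balaban1983to89
open Literature.MathematicalPhysics.QuantumFieldTheory.Balaban1983to89.T3ContinuumYM3Torus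
open T3SectALandauChart (eta)
open B9SectCLatticeCarrier (Bond)
open B9Eq311L2Pairing (WL2)
open B11Eq103H1Complex (SiteL2K BondL2K)
open Summit.QuantumFields.YangMills.Theorems.Prop7SectET3Transport (periodsT3)
open Summit.QuantumFields.YangMills.Theorems.Prop7SectET3HilbertLetters (W₂ toL2 toL2B)
open Summit.QuantumFields.YangMills.Theorems.Prop7SectET3WilsonHessian (DeltaEta DeltaEta_toL2_star)
open Summit.QuantumFields.YangMills.Theorems.Prop7SectET3DeltaPi (H46)
open Summit.QuantumFields.YangMills.Theorems.Prop7SymAvgTwSym (QTwS)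
open Summit.QuantumFields.YangMills.Theorems.Prop7H46RealityTrace (H46_skewHermitian_traceless)
open Summit.QuantumFields.YangMills.Theorems.Prop7QTwSRealitySectors (trace_QTwS_eq_zero_of_regPr QTwS_star_comm_of_regPr_of_realScalar QTwS_scalar_of_realScalar)
open T3PrintedRegularMinimiser (RegPr)
open Summit.QuantumFields.YangMills.Theorems.Prop7WilsonHessianSectorRows (trace_DeltaEta_toL2_eq_zero)

variable {F : T3Family} {n K : ℕ} {c₀ : ℝ} [Fact (0 < c₀)]

/-- ★★ **`Δ^η(U₀)` COMMUTES WITH THE CONJUGATION `σ = toL2 ∘ star ∘ toL2⁻¹`, IN THE `σ`-SPELLING OF THE ASSEMBLY** — p01's ✓`DeltaEta_toL2_star` (the Hessian-slot σ-row, proved from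
✓`hessFormRe_conj`) read at `X := toL2⁻¹ f`; this is the `hΔη` binder of ✓`Prop7H46RealityTrace.H46_skewHermitian_traceless` ∕ ✓`Prop7H46Reality.H46_star_comm` verbatim.
[cite: Balaban1985BackgroundPropagators, (3.10)–(3.12) p.392, p.393] -/
theorem DeltaEta_star_comm (U₀ : GaugeField (F.P K) 0 (Matrix.specialUnitaryGroup (Fin 2) ℂ)) (f : BondL2K ℂ 3 (periodsT3 F K) c₀ W₂) :
    DeltaEta F n K c₀ U₀ (toL2 F K c₀ (star ((toL2 F K c₀).symm f))) = toL2 F K c₀ (star ((toL2 F K c₀).symm (DeltaEta F n K c₀ U₀ f))) := by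
  have key := DeltaEta_toL2_star (F := F) (n := n) (K := K) (c₀ := c₀) U₀ ((toL2 F K c₀).symm f)
  rwa [LinearEquiv.apply_symm_apply] at key

/-- ★★★ **THE KNIT'S (R-H) CLAUSE FOR `H := H46 U₀` WITH `hΔη` DISCHARGED**: skew-Hermitian traceless block data give a skew-Hermitian traceless field, given the `QTwS` star-row `hQ`
and its two sectors `hQtr` ((Q-a)-traceless), `hQsc` ((Q-b) scalar), and the traceless sector `hΔtr` of `Δ^η`.
[cite: Balaban1985Variational, (45)–(46) p.285, (51) p.286; Balaban1985BackgroundPropagators, (3.126) p.420, (3.12) p.392, p.393] -/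
theorem H46_skewHermitian_traceless_of_rows (h : n ≤ K) (cB a : ℝ) [Fact (0 < cB)] (U₀ : GaugeField (F.P K) 0 (Matrix.specialUnitaryGroup (Fin 2) ℂ))
    (hQ : ∀ A : PBond (F.P K) 0 → Matrix (Fin 2) (Fin 2) ℂ, QTwS F n K h U₀ (star A) = star (QTwS F n K h U₀ A))
    (hQtr : ∀ A : PBond (F.P K) 0 → Matrix (Fin 2) (Fin 2) ℂ, (∀ b, (A b).trace = 0) → ∀ c, (QTwS F n K h U₀ A c).trace = 0)
    (hQsc : ∀ c : PBond (F.P K) 0 → ℂ, ∃ d : PBond (F.P n) 0 → ℂ, QTwS F n K h U₀ (fun b => c b • (1 : Matrix (Fin 2) (Fin 2) ℂ)) = fun c' => d c' • 1)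
    (hΔtr : ∀ A : PBond (F.P K) 0 → Matrix (Fin 2) (Fin 2) ℂ, (∀ b, (A b).trace = 0) → ∀ b, ((toL2 F K c₀).symm (DeltaEta F n K c₀ U₀ (toL2 F K c₀ A)) b).trace = 0) :
    ∀ Y : PBond (F.P n) 0 → Matrix (Fin 2) (Fin 2) ℂ, (∀ c, star (Y c) = -Y c ∧ (Y c).trace = 0) →
      ∀ b, star (H46 F n K h c₀ cB a U₀ Y b) = -H46 F n K h c₀ cB a U₀ Y b ∧ (H46 F n K h c₀ cB a U₀ Y b).trace = 0 :=
  H46_skewHermitian_traceless F n K h c₀ cB a U₀ hQ (DeltaEta_star_comm U₀) hQtr hQsc hΔtr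

/-- ★★★ **THE KNIT'S (R-H) CLAUSE FOR `H := H46 U₀` AT `U₀ ∈ 𝔘_k(ε₀)` MODULO TWO DISPLAYED ROWS**: in the windows `10⁹L²e ≤ 1`, `10¹²L³ε₀ ≤ 1`, given (Q-b)ʳ `hscR` («`QTwS U₀` maps real
scalar fields `r·1` to real scalar fields», ★w5-20520 lineage) and the traceless sector `hΔtr` of `Δ^η_{U₀}`: skew-Hermitian traceless block data give a skew-Hermitian traceless field —
the three `QTwS` rows come from (Q-a) ✓`Prop7QTwSReality` + `hscR` through p03's ✓`Prop7QTwSRealitySectors`, `hΔη` from `DeltaEta_star_comm`.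
[cite: Balaban1985Variational, (45)–(46) p.285, (51) p.286; Balaban1985BackgroundPropagators, (3.126) p.420, (3.12)–(3.14) pp.392–393] -/
theorem H46_skewHermitian_traceless_of_regPr [Fact (0 < (F.L : ℝ))] [Fact (0 < ((F.L : ℝ)⁻¹) ^ (K - n))] (h : n ≤ K) (cB a : ℝ) [Fact (0 < cB)]
    {ε₀ e : ℝ} (hε₀ : 0 < ε₀) (he : 0 < e) (hWe : 10 ^ 9 * (F.L : ℝ) ^ 2 * e ≤ 1) (hWε : 10 ^ 12 * (F.L : ℝ) ^ 3 * ε₀ ≤ 1)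
    (U₀ : GaugeField (F.P K) 0 (Matrix.specialUnitaryGroup (Fin 2) ℂ)) (hreg : RegPr F n K ε₀ U₀)
    (hscR : ∀ r : PBond (F.P K) 0 → ℝ, ∃ s : PBond (F.P n) 0 → ℝ,
      QTwS F n K h U₀ (fun b => ((r b : ℝ) : ℂ) • (1 : Matrix (Fin 2) (Fin 2) ℂ)) = fun c => ((s c : ℝ) : ℂ) • (1 : Matrix (Fin 2) (Fin 2) ℂ))
    (hΔtr : ∀ A : PBond (F.P K) 0 → Matrix (Fin 2) (Fin 2) ℂ, (∀ b, (A b).trace = 0) → ∀ b, ((toL2 F K c₀).symm (DeltaEta F n K c₀ U₀ (toL2 F K c₀ A)) b).trace = 0) :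
    ∀ Y : PBond (F.P n) 0 → Matrix (Fin 2) (Fin 2) ℂ, (∀ c, star (Y c) = -Y c ∧ (Y c).trace = 0) →
      ∀ b, star (H46 F n K h c₀ cB a U₀ Y b) = -H46 F n K h c₀ cB a U₀ Y b ∧ (H46 F n K h c₀ cB a U₀ Y b).trace = 0 :=
  H46_skewHermitian_traceless_of_rows h cB a U₀ (QTwS_star_comm_of_regPr_of_realScalar F h hε₀ he hWe hWε U₀ hreg hscR)
    (fun A hA c => trace_QTwS_eq_zero_of_regPr F h hε₀ he hWe hWε U₀ hreg A hA c) (QTwS_scalar_of_realScalar F h U₀ hscR) hΔtr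

/-- ★★★ **THE KNIT'S (R-H) CLAUSE FOR `H := H46 U₀` AT `U₀ ∈ 𝔘_k(ε₀)` MODULO THE SINGLE ROW (Q-b)ʳ**: in the windows `10⁹L²e ≤ 1`, `10¹²L³ε₀ ≤ 1`, given ONLY `hscR` («`QTwS U₀` maps real scalar fields
`r·1` to real scalar fields» — the centre-equivariance of the exp-mean-log tower, ★w5-20520 lineage), skew-Hermitian traceless block data give a skew-Hermitian traceless field: the
traceless sector of `Δ^η` is now a THEOREM (✓`Prop7WilsonHessianSectorRows.trace_DeltaEta_toL2_eq_zero`, the second Δ-slot row), `hΔη` is p01's ✓`DeltaEta_toL2_star`, the `QTwS` rows are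
(Q-a) ✓`Prop7QTwSReality` + `hscR` through p03's ✓`Prop7QTwSRealitySectors`. [cite: Balaban1985Variational, (45)–(46) p.285, (51) p.286; Balaban1985BackgroundPropagators, (3.126) p.420, (3.12)–(3.14) pp.392–393] -/
theorem H46_skewHermitian_traceless_of_regPr_of_realScalar [Fact (0 < (F.L : ℝ))] [Fact (0 < ((F.L : ℝ)⁻¹) ^ (K - n))] (h : n ≤ K) (cB a : ℝ) [Fact (0 < cB)]
    {ε₀ e : ℝ} (hε₀ : 0 < ε₀) (he : 0 < e) (hWe : 10 ^ 9 * (F.L : ℝ) ^ 2 * e ≤ 1) (hWε : 10 ^ 12 * (F.L : ℝ) ^ 3 * ε₀ ≤ 1)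
    (U₀ : GaugeField (F.P K) 0 (Matrix.specialUnitaryGroup (Fin 2) ℂ)) (hreg : RegPr F n K ε₀ U₀)
    (hscR : ∀ r : PBond (F.P K) 0 → ℝ, ∃ s : PBond (F.P n) 0 → ℝ,
      QTwS F n K h U₀ (fun b => ((r b : ℝ) : ℂ) • (1 : Matrix (Fin 2) (Fin 2) ℂ)) = fun c => ((s c : ℝ) : ℂ) • (1 : Matrix (Fin 2) (Fin 2) ℂ)) :
    ∀ Y : PBond (F.P n) 0 → Matrix (Fin 2) (Fin 2) ℂ, (∀ c, star (Y c) = -Y c ∧ (Y c).trace = 0) →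
      ∀ b, star (H46 F n K h c₀ cB a U₀ Y b) = -H46 F n K h c₀ cB a U₀ Y b ∧ (H46 F n K h c₀ cB a U₀ Y b).trace = 0 :=
  H46_skewHermitian_traceless_of_regPr h cB a hε₀ he hWe hWε U₀ hreg hscR (fun A hA b => trace_DeltaEta_toL2_eq_zero U₀ A hA b)

end Summit.QuantumFields.YangMills.Theorems.Prop7DeltaEtaStarReality

end
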